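import Literature.NumberTheory.EllipticCurves.ManinConstantModularDegree
import Summits.BirchSwinnertonDyer.Rank1Residual.ManinAdditive.WildResiduals
import HarnessLib
import HarnessLib.Audit.Tags

/-!
# Sketch3-imc-g25 (v2) — the CNS inequality at 3 below 3⁵ (machine theorem THM 29.AP + COR 29.AQ, PROOFS-g25 §10),
# typed as ONE new row E-imc-194 plus the residual row E-imc-195 (3⁵ ∣ N), with PROVED book-keeping:
#   print ∧ E-imc-190 ⟹ E-imc-194;   E-imc-194 ∧ E-imc-195 ⟹ E-imc-190;   E-imc-194 ⟹ C3's conclusion on the slice «3 ∤ deg φ».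
# So E-imc-190 (`WildResiduals.CNSInequalityWildThree`, in the tree) SPLITS as (machine theorem) ∧ (n = 5 residual).
# Statement-only candidate rows; nothing here is a route item.  No new notion; cites tree decls by name.

TYPER NOTE (typer g21, T-imc-44).  SOURCE = HOME/imc/kit-g25/Sketch3-imc-g25.lean (v2) sha16 5fa86bea89fcbe2e (81 l.; imc: farm
rc 0 · 0 warnings · 0 s∗rries) VERBATIM except this note, `import HarnessLib.Audit.Tags`, and the attribute `@[conjecture]` on the
two research nodes (cell convention for beyond-print rows, as E-imc-190/191 in `WildResiduals.lean` and E-imc-193 in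
`WildTwoOffPowers.lean`; bodies untouched).  Sibling of `WildResiduals.lean` / `WildTwoOffPowers.lean`, namespace
`…ManinAdditive.WildThree` as written — ROUTE-INDEPENDENT (imports `Literature…ManinConstantModularDegree` + the landed
`…ManinAdditive.WildResiduals` + HarnessLib).  HONEST FRAMING (typer summary; details = imc's text): LENS imc (integrality of the
cotangent lattice / rational singularities of `X₀(N)` over `ℤ₍₃₎`).  ROWS: **E-imc-194 `CNSInequalityAtThreeBelow243`** = the
Česnavičius–Neururer–Saha inequality `v₃(c_φ) ≤ v₃(deg φ)` for EVERY conductor-level parametrisation datum with `3⁵ ∤ N` (no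
congruence condition) — imc's MACHINE theorem THM 29.AP (ENGINE L₃: the wild ℤ/3-quotient singularity of `X₀(3ⁿM′)` at 3 is a
rational triple point for n = 2, 3, 4) + Artin's criterion ⟹ COR 29.AQ (`X₀(N)_{ℤ₍₃₎}` has rational singularities for `3⁵ ∤ N`) ⟹
E-imc-194 by the printed main-general clause of [CesnaviciusNeururerSaha2023, Thm 1.2] (HOME/imc/kit-g25/PROOFS-g25.md §10,
sha16 2fe08f9d95e3a14e at landing; engine files + logs listed in HOME/imc/kit-g25/SHA16-g25.txt); refuter audit **R-imc-86 PENDING**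
at landing time ⇒ obligation node («machine theorem pending audit», imc), NOT a Literature fact; **E-imc-195
`CNSInequalityWildThreeAt243`** = the RESIDUAL of E-imc-190 after E-imc-194 (`3⁵ ∣ N` on CNS's excluded class; ENGINE L₃ at n = 5 =
kit job j334025 pending / the all-n paper argument) — unproved.  PROVED (imc, pure bookkeeping, kernel-checked here):
`below243_of_cns_of_wildThree` (printed fact ∧ E-imc-190 ⟹ E-imc-194), `wildThree_of_below243_of_at243` (E-imc-194 ∧ E-imc-195 ⟹
E-imc-190 = `WildResiduals.CNSInequalityWildThree`, i.e. E-190 SPLITS as machine theorem ∧ n = 5 residual),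
`padicVal_three_maninConstant_le_modularDegree` (fact ∧ E-194 ∧ E-195 ⟹ the inequality at 3 for every datum),
`not_three_dvd_maninConstant_of_not_three_dvd_modularDegree` (E-imc-194 ⟹ the CONCLUSION of crux C3 `ManinPrimeToThreeAtNine`
(stmt-BirchSwinnertonDyer-22968) on the slice «3 ∤ deg φ, 3⁵ ∤ N», no optimality, no fact hypothesis).  NOT IN PRINT: CNS Thm 1.2
excludes exactly the class `27 ∣ N ∧ (∀ q ∣ N prime, q ≢ 2 mod 3)`; E-imc-194 ∩ that class (`v₃(N) ∈ {3, 4}`) and all of E-imc-195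
are beyond print.  BC5 WITNESS (typer run, HOME/MANIN-ADDITIVE-CREMONA-TIER-v1.tsv.gz sha16 9e900c04e95a8bd4, 984 410 Cremona-certified
optimal classes with `4 ∣ N ∨ 27 ∣ N`, `N < 5·10⁵`): E-imc-194 population `v₃(N) ≤ 4`: meets 965 319 · beyond print (v₃(N) ∈ {3,4},
no prime `q ≡ 2 mod 3`) 5 733 (= 4 265 + 1 468, agreeing with imc's g23 census in `WildResiduals.lean`) · violations 0; E-imc-195
population (`v₃(N) ≥ 5`, no `q ≡ 2 mod 3`): meets 977 · beyond print 977 · violations 0 (all `c = 1`).  CHEAPEST FALSIFIER: an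
optimal curve with `3 ∣ c`, `3 ∤ deg φ` and `3⁵ ∤ N` (E-194) resp. `3⁵ ∣ N` (E-195); none in the table.  REFUTER VERDICTS: ref1
R-imc-86 PENDING; ref2 PENDING.  Typer checks: the six decl names are fresh tree-wide (rg); `not_dvd_maninConstant_of_padicVal_le_of_not_dvd`
is the tree lemma in `Literature…ManinConstantModularDegree`; no instances, no notation; own farm check recorded in HOME/STATUS.
PARTITION ladder-adjacent · beyond-print theorem: NO (machine-theorem candidate, audit pending) · bears_on:
stmt-BirchSwinnertonDyer-22968 (C3, slice edge).  BSD is not proved by this; Manin `c = 1` is not proved by this; E-imc-194/195,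
C3 OPEN.

APPEND (typer g21, T-imc-45, after landing as p734461): (i) docstring status refresh asked by imc g25 17:19Z — E-imc-194 «audited
(REFUTER §R179 + by-name ADDENDUM)», E-imc-195 «machine + paper theorem per PROOFS-g25 §11 (THM 29.AP∞), audit R-imc-87 pending»; the
two `@[conjecture]` BODIES are unchanged (landed bodies are immutable); (ii) one new PROVED by-name slice edge
`cnsBoundAtWildTwentySeven_of_below243 : CNSInequalityAtThreeBelow243 → WildTwentySeven.CNSBoundAtWildTwentySeven` (E-imc-194 ⟹ E-imc-185:
`27 ∥ N` forces `3⁵ ∤ N`), so the `27 ∥ N` node E-imc-185 (p713083) now hangs off the audited machine-theorem node alone.  The sibling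
refreshes for E-imc-190/191 (`WildResiduals.lean`) and E-imc-193 (`WildTwoOffPowers.lean`) are docstring-only and ride with the next
substantive append to those files (gate `dup.identical` on comment-only resubmissions).
-/

noncomputable section

namespace Summit.BirchSwinnertonDyer.Rank1Residual.ManinAdditive.WildThree

open Literature.NumberTheory.EllipticCurves.ModularForms
open Summit.BirchSwinnertonDyer.Rank1Residual.ManinAdditive.WildResiduals

/-- candidate **E-imc-194** (imc g25, PROOFS-g25 §10: ENGINE L₃ decides p_a(Z_fund) = 0 for the wild ℤ/3-quotient
singularity 𝔖′_{3ⁿ} of X₀ at 3, n = 2, 3, 4 (THM 29.AP, machine) ⟹ X₀(N)_{ℤ₍₃₎} has rational singularities whenever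
3⁵ ∤ N (COR 29.AQ) ⟹ by the printed clause of Česnavičius–Neururer–Saha Thm 1.2 the inequality below; AUDITED:
REFUTER-ref1 §R179 (R-imc-86 ANSWERED 2026-08-29T17:13Z — PROOFS-g25 §10 hooks (a)–(h) SOUND, Artin's criterion pinned to
Lipman 1969 Publ. IHES 36 Thm (27.1), ENGINE L₃ replays byte-identical with independently re-derived exact inputs; by name on
this file §R179 ADDENDUM 17:17Z); kernel status: obligation node (machine theorem)): the CNS inequality at `p = 3` for every
conductor-level parametrisation datum with `3⁵ ∤ N`.
Why it might fail: only if the machine resolution (KL-goodness, Hurwitz data, Artin's criterion) or the printed wording of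
CNS Thm 1.2 (main-general) fails.  Census: every Cremona optimal curve with 27 ∣ N has 3 ∤ c (cell table v3). -/
@[conjecture]
def CNSInequalityAtThreeBelow243 : Prop :=
  ∀ (W : WeierstrassCurve ℚ) [W.IsElliptic] [W.IsGloballyMinimal] [NeZero (W.conductorNorm ℤ)]
    (D : ModularParametrizationData W (W.conductorNorm ℤ)),
    ¬ 3 ^ 5 ∣ W.conductorNorm ℤ →
    padicValInt 3 D.maninConstant ≤ padicValNat 3 D.modularDegree

/-- candidate **E-imc-195** (the RESIDUAL of E-imc-190 after E-imc-194: conductor exponent 5 at 3, i.e. `3⁵ ∣ N`, on CNS's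
excluded class; ENGINE L₃ at n = 5 pending kit job j334025 / the all-n paper argument).  Status 2026-08-29T17:19Z (imc g25):
machine + paper theorem per PROOFS-g25 §11 (SHADOW PRINCIPLE, THM 29.AP∞: the wild ℤ/3-quotient singularity of X₀(3ⁿM′) is
rational for EVERY n ≥ 2), audit R-imc-87 PENDING; kernel status: obligation node: -/
@[conjecture]
def CNSInequalityWildThreeAt243 : Prop :=
  ∀ (W : WeierstrassCurve ℚ) [W.IsElliptic] [W.IsGloballyMinimal] [NeZero (W.conductorNorm ℤ)]
    (D : ModularParametrizationData W (W.conductorNorm ℤ)),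
    3 ^ 5 ∣ W.conductorNorm ℤ → (∀ q : ℕ, q.Prime → q ∣ W.conductorNorm ℤ → q % 3 ≠ 2) →
    padicValInt 3 D.maninConstant ≤ padicValNat 3 D.modularDegree

/-- PROVED: the printed CNS fact together with the tree row E-imc-190 gives E-imc-194 (so E-imc-194 is a slice of the
existing programme, not a new direction of it). -/
theorem below243_of_cns_of_wildThree
    (hCNS : cesnaviciusNeururerSaha_padicVal_maninConstant_le_modularDegree)
    (h190 : CNSInequalityWildThree) : CNSInequalityAtThreeBelow243 := by
  intro W _ _ _ D _
  by_cases hx : (3 ^ 3 ∣ W.conductorNorm ℤ ∧ ∀ q : ℕ, q.Prime → q ∣ W.conductorNorm ℤ → q % 3 ≠ 2)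
  · exact h190 W D hx.1 hx.2
  · exact hCNS W D 3 (by norm_num) (fun h2 => by omega) (fun h3 => hx ⟨h3.2.1, h3.2.2⟩)

/-- PROVED: E-imc-190 SPLITS as E-imc-194 ∧ E-imc-195. -/
theorem wildThree_of_below243_of_at243 (h194 : CNSInequalityAtThreeBelow243)
    (h195 : CNSInequalityWildThreeAt243) : CNSInequalityWildThree := by
  intro W _ _ _ D h27 hq
  by_cases h243 : 3 ^ 5 ∣ W.conductorNorm ℤ
  · exact h195 W D h243 hq
  · exact h194 W D h243

/-- PROVED: with the printed fact, E-imc-194 and E-imc-195 give the CNS inequality at 3 for EVERY datum. -/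
theorem padicVal_three_maninConstant_le_modularDegree
    (hCNS : cesnaviciusNeururerSaha_padicVal_maninConstant_le_modularDegree)
    (h194 : CNSInequalityAtThreeBelow243) (h195 : CNSInequalityWildThreeAt243)
    (W : WeierstrassCurve ℚ) [W.IsElliptic] [W.IsGloballyMinimal] [NeZero (W.conductorNorm ℤ)]
    (D : ModularParametrizationData W (W.conductorNorm ℤ)) :
    padicValInt 3 D.maninConstant ≤ padicValNat 3 D.modularDegree := by
  by_cases hx : (3 ^ 3 ∣ W.conductorNorm ℤ ∧ ∀ q : ℕ, q.Prime → q ∣ W.conductorNorm ℤ → q % 3 ≠ 2)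
  · exact wildThree_of_below243_of_at243 h194 h195 W D hx.1 hx.2
  · exact hCNS W D 3 (by norm_num) (fun h2 => by omega) (fun h3 => hx ⟨h3.2.1, h3.2.2⟩)

/-- PROVED edge: E-imc-194 proves the CONCLUSION of the crux `ManinPrimeToThreeAtNine` (stmt-22968) on the slice
«conductor-level datum with 3 ∤ deg φ and 3⁵ ∤ N» (no optimality, no fact hypotheses). -/
theorem not_three_dvd_maninConstant_of_not_three_dvd_modularDegree (h194 : CNSInequalityAtThreeBelow243)
    (W : WeierstrassCurve ℚ) [W.IsElliptic] [W.IsGloballyMinimal] [NeZero (W.conductorNorm ℤ)]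
    (D : ModularParametrizationData W (W.conductorNorm ℤ))
    (hN : ¬ 3 ^ 5 ∣ W.conductorNorm ℤ) (hdeg : ¬ 3 ∣ D.modularDegree) :
    ¬ (3 : ℤ) ∣ D.maninConstant := by
  have h := not_dvd_maninConstant_of_padicVal_le_of_not_dvd D (by norm_num : (3 : ℕ).Prime) (h194 W D hN) hdeg
  simpa [ModularParametrizationData.maninConstant] using h

/-- **Typer slice edge (by name, typer g21 T-imc-45): E-imc-194 ⟹ E-imc-185** (`WildTwentySeven.CNSBoundAtWildTwentySeven`,
p713083): a conductor with `27 ∥ N` has `3⁴ ∤ N`, hence `3⁵ ∤ N`, so the `27 ∥ N` slice of CNS's excluded class is covered by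
the audited machine-theorem node E-imc-194 (no use of E-imc-190/195). -/
theorem cnsBoundAtWildTwentySeven_of_below243 (h194 : CNSInequalityAtThreeBelow243) :
    WildTwentySeven.CNSBoundAtWildTwentySeven :=
  fun W _ _ _ D _ h81 _ => h194 W D fun h243 => h81 (dvd_trans (pow_dvd_pow 3 (by norm_num)) h243)

end Summit.BirchSwinnertonDyer.Rank1Residual.ManinAdditive.WildThree

end
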